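import Summits.CriticalPhenomena.PercolationContinuityZ3.Theorems.Transplant.SharpnessUnitCylinderWitnessNilpotent
import HarnessLib

/-!
# The (κ′) threshold of the filiform witness is EXACTLY 2: the width-2 cylinder `C₂ = {|k| ≤ 2, |v₀| ≤ 2}` of the letters chart of `Q = ℤ⁴ ⋊_J ℤ` induces a
# CONNECTED subgraph of `Cay(Q; a^{±1}, b^{±1})` (while `C₁` is disconnected, «SharpnessUnitCylinderWitness» p443439)

builds on p205010 (kernel theorem, internal audit signed; external expert review pending) — nothing here uses p205010; NOTHING is claimed about any open node.
Lane `prim-bschramm`, seat `prim-bschramm-p5` gen 24 (refuter; P5-SHARPNESS §54.13, row 89's (κ′) column; class B).  Helper file (`--supports stmt-CriticalPhenomena-4575 --as helper`).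
PROOF (explicit words inside `C₂`).  `a`-moves change `k` only; a `b`-move at level `k` adds `J^k e₀`.  Gadgets at a lattice vertex `(v, 0)` with `|v₀| ≤ 1`:
`+e₁ = a b a⁻¹ b⁻¹` (levels 0,1), `+e₂ = a a b a⁻¹ b⁻¹ a⁻¹ b a b⁻¹ a⁻¹` (levels 0,1,2: `J²e₀ − 2Je₀ + e₀ = e₂`), `+e₃ = b · (−e₁) · (+e₂) · a⁻¹ b⁻¹ a`
(`e₀ − e₁ + e₂ − J⁻¹e₀ = e₃`, levels −1…2); every intermediate vertex has `|k| ≤ 2`, `|v₀| ≤ 2`.  Then every `(v, k) ∈ C₂` is joined inside `C₂` to `(v, 0)` (a-moves), to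
`(v − v₀e₀, 0)` (b-moves at level 0) and to `1` (the gadgets, by induction on `v₃, v₂, v₁`).  So `ℓ₀ = 2` is the exact (κ′) threshold of this U-customer's letters chart.
[cite: KozmaNitzan2024, §4 p. 15 (boxes: connected induced cylinders)] [cite: BenjaminiSchramm1996, §2 (Cayley graphs)]
-/

noncomputable section

namespace Summit.CriticalPhenomena.PercolationContinuityZ3.Theorems.Transplant

open SimpleGraph Literature.Probability.LatticeModels Literature.Probability.Percolation Multiplicative

namespace Filiform

/-! ## §1 Coordinates `(v, k)`, the four moves, the width-2 cylinder -/

/-- The element `(v, k)` of `Q`. [folklore] -/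
def mk (v : Fin 4 → ℤ) (k : ℤ) : Q := ⟨ofAdd v, ofAdd k⟩

/-- `(mk v k).left = v`. [folklore] -/
@[simp] theorem toAdd_mk_left (v : Fin 4 → ℤ) (k : ℤ) : toAdd (mk v k).left = v := rfl

/-- `(mk v k).right = k`. [folklore] -/
@[simp] theorem toAdd_mk_right (v : Fin 4 → ℤ) (k : ℤ) : toAdd (mk v k).right = k := rfl

/-- Every element is some `(v, k)`. [folklore] -/
theorem mk_eta (x : Q) : x = mk (toAdd x.left) (toAdd x.right) := by
  refine SemidirectProduct.ext ?_ ?_ <;> simp [mk]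

/-- `(v,k) · a = (v, k+1)`. [folklore] -/
theorem mk_mul_a (v : Fin 4 → ℤ) (k : ℤ) : mk v k * a = mk v (k + 1) := by
  refine SemidirectProduct.ext ?_ ?_
  · simp [mk, a, SemidirectProduct.mul_left]
  · simp [mk, a, SemidirectProduct.mul_right, ← ofAdd_add]

/-- `(v,k) · a⁻¹ = (v, k−1)`. [folklore] -/
theorem mk_mul_a_inv (v : Fin 4 → ℤ) (k : ℤ) : mk v k * a⁻¹ = mk v (k - 1) := by
  rw [mul_inv_eq_iff_eq_mul, mk_mul_a, sub_add_cancel]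

/-- `a`-move with the target level supplied. [folklore] -/
theorem mk_mul_a' (v : Fin 4 → ℤ) (k k' : ℤ) (h : k + 1 = k') : mk v k * a = mk v k' := by rw [mk_mul_a, h]

/-- `a⁻¹`-move with the target level supplied. [folklore] -/
theorem mk_mul_a_inv' (v : Fin 4 → ℤ) (k k' : ℤ) (h : k - 1 = k') : mk v k * a⁻¹ = mk v k' := by rw [mk_mul_a_inv, h]

/-- `(v,k) · b = (v + J^k e₀, k)`. [folklore] -/
theorem mk_mul_b (v : Fin 4 → ℤ) (k : ℤ) : mk v k * b = mk (v + toAdd ((J ^ k) (ofAdd (e 0)))) k := by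
  refine SemidirectProduct.ext ?_ ?_
  · apply toAdd.injective
    simp [mk, b, lat, SemidirectProduct.mul_left, act_apply]
  · simp [mk, b, lat, SemidirectProduct.mul_right]

/-- `(v,k) · b⁻¹ = (v − J^k e₀, k)`. [folklore] -/
theorem mk_mul_b_inv (v : Fin 4 → ℤ) (k : ℤ) : mk v k * b⁻¹ = mk (v - toAdd ((J ^ k) (ofAdd (e 0)))) k := by
  rw [mul_inv_eq_iff_eq_mul, mk_mul_b, sub_add_cancel]

/-- `J⁰ e₀ = e₀ = (1,0,0,0)`. [folklore] -/
theorem Jpow_zero_e0 : toAdd ((J ^ (0 : ℤ)) (ofAdd (e 0))) = ![1, 0, 0, 0] := by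
  rw [zpow_zero, MulAut.one_apply, toAdd_ofAdd]; ext i; fin_cases i <;> simp [e]

/-- `J¹ e₀ = (1,1,0,0)`. [folklore] -/
theorem Jpow_one_e0 : toAdd ((J ^ (1 : ℤ)) (ofAdd (e 0))) = ![1, 1, 0, 0] := by
  rw [zpow_one, J_ofAdd, toAdd_ofAdd]; ext i; fin_cases i <;> simp [jmap, e]

/-- `J² e₀ = (1,2,1,0)`. [folklore] -/
theorem Jpow_two_e0 : toAdd ((J ^ (2 : ℤ)) (ofAdd (e 0))) = ![1, 2, 1, 0] := by
  rw [zpow_two, MulAut.mul_apply, J_ofAdd, J_ofAdd, toAdd_ofAdd]; ext i; fin_cases i <;> simp [jmap, e]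

/-- `J⁻¹ e₀ = (1,−1,1,−1)`. [folklore] -/
theorem Jpow_neg_one_e0 : toAdd ((J ^ (-1 : ℤ)) (ofAdd (e 0))) = ![1, -1, 1, -1] := by
  rw [zpow_neg_one, MulAut.inv_apply, J_symm_ofAdd, toAdd_ofAdd]; ext i; fin_cases i <;> simp [jinv, e]

/-- **The width-2 cylinder** `C₂ = {x : φ x ∈ Λ₂}`. [cite: KozmaNitzan2024, §4 p. 15 (boxes)] -/
def cylTwo : Set Q := {x | φ x ∈ box 2 2}

/-- Membership of `(v, k)` in `C₂`. [folklore] -/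
theorem mk_mem_cylTwo {v : Fin 4 → ℤ} {k : ℤ} : mk v k ∈ cylTwo ↔ |k| ≤ 2 ∧ |v 0| ≤ 2 := by
  rw [cylTwo, Set.mem_setOf_eq, mem_box, Fin.forall_fin_two, φ_apply_zero, φ_apply_one, abs_le, abs_le, toAdd_mk_right, toAdd_mk_left]
  push_cast
  exact Iff.rfl

/-- No letter is trivial. [folklore] -/
theorem ne_one_of_mem_S {s : Q} (hs : s ∈ S) : s ≠ 1 := by
  intro h
  simp only [S, Finset.mem_insert, Finset.mem_singleton] at hs
  have h0 := congrArg φ h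
  rw [φ_one] at h0
  rcases hs with rfl | rfl | rfl | rfl
  · rw [φ_a] at h0; simpa using congrFun h0 0
  · rw [φ_inv, φ_a] at h0; simpa using congrFun h0 0
  · rw [φ_b] at h0; simpa using congrFun h0 1
  · rw [φ_inv, φ_b] at h0; simpa using congrFun h0 1

/-- **One move inside `C₂`** is an edge of the induced graph. [folklore] -/
theorem reach_of_eq {x y : Q} (hx : x ∈ cylTwo) (hy : y ∈ cylTwo) (s : Q) (hs : s ∈ S) (h : x * s = y) :
    ((mulCayley (↑S : Set Q)).induce cylTwo).Reachable ⟨x, hx⟩ ⟨y, hy⟩ := by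
  subst h
  refine Adj.reachable ?_
  rw [induce_adj, mulCayley_adj]
  refine ⟨fun h => ne_one_of_mem_S hs (mul_left_cancel (a := x) (by rw [mul_one]; exact h.symm)), Or.inl ?_⟩
  rw [inv_mul_cancel_left]; exact hs

/-! ## §2 `a`-moves: every `(v, k) ∈ C₂` is joined to `(v, 0)` -/

/-- `(v, k) ↝ (v, 0)` inside `C₂` (for `|k| ≤ 2`, `|v₀| ≤ 2`). [folklore] -/
theorem reach_level_zero (v : Fin 4 → ℤ) {k : ℤ} (hk : |k| ≤ 2) (hv : |v 0| ≤ 2) :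
    ((mulCayley (↑S : Set Q)).induce cylTwo).Reachable ⟨mk v k, mk_mem_cylTwo.2 ⟨hk, hv⟩⟩ ⟨mk v 0, mk_mem_cylTwo.2 ⟨by simp, hv⟩⟩ := by
  have ha : a ∈ S := by simp [S]
  have hai : a⁻¹ ∈ S := by simp [S]
  have mem : ∀ j : ℤ, |j| ≤ 2 → mk v j ∈ cylTwo := fun j hj => mk_mem_cylTwo.2 ⟨hj, hv⟩
  -- down-steps `(v, j) → (v, j-1)` and up-steps `(v, j) → (v, j+1)`
  have dn : ∀ j : ℤ, ∀ (hj : |j| ≤ 2) (hj' : |j - 1| ≤ 2),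
      ((mulCayley (↑S : Set Q)).induce cylTwo).Reachable ⟨mk v j, mem j hj⟩ ⟨mk v (j - 1), mem _ hj'⟩ :=
    fun j hj hj' => reach_of_eq (mem j hj) (mem _ hj') _ hai (mk_mul_a_inv v j)
  have up : ∀ j : ℤ, ∀ (hj : |j| ≤ 2) (hj' : |j + 1| ≤ 2),
      ((mulCayley (↑S : Set Q)).induce cylTwo).Reachable ⟨mk v j, mem j hj⟩ ⟨mk v (j + 1), mem _ hj'⟩ :=
    fun j hj hj' => reach_of_eq (mem j hj) (mem _ hj') _ ha (mk_mul_a v j)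
  rw [abs_le] at hk
  have hk' : k = -2 ∨ k = -1 ∨ k = 0 ∨ k = 1 ∨ k = 2 := by omega
  rcases hk' with rfl | rfl | rfl | rfl | rfl
  · exact ((up (-2) (by norm_num) (by norm_num)).trans (by norm_num; exact up (-1) (by norm_num) (by norm_num))).trans (by norm_num)
  · exact (up (-1) (by norm_num) (by norm_num)).trans (by norm_num)
  · rfl
  · exact (dn 1 (by norm_num) (by norm_num)).trans (by norm_num)
  · exact ((dn 2 (by norm_num) (by norm_num)).trans (by norm_num; exact dn 1 (by norm_num) (by norm_num))).trans (by norm_num)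

/-! ## §3 Bookkeeping helpers -/

/-- Reachability in the induced `C₂`-graph, with the membership proofs supplied. [folklore] -/
def RC (x y : Q) : Prop := ∀ (hx : x ∈ cylTwo) (hy : y ∈ cylTwo), ((mulCayley (↑S : Set Q)).induce cylTwo).Reachable ⟨x, hx⟩ ⟨y, hy⟩

/-- `RC` is reflexive. [folklore] -/
theorem RC.rfl' {x : Q} : RC x x := fun _ _ => Reachable.refl _

/-- `RC` along an equality. [folklore] -/
theorem RC.of_eq {x y : Q} (h : x = y) : RC x y := by subst h; exact RC.rfl'

/-- `RC` is symmetric. [folklore] -/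
theorem RC.symm {x y : Q} (h : RC x y) : RC y x := fun hy hx => (h hx hy).symm

/-- `RC` is transitive THROUGH a vertex of `C₂`. [folklore] -/
theorem RC.trans {x y z : Q} (h₁ : RC x y) (hy : y ∈ cylTwo) (h₂ : RC y z) : RC x z := fun hx hz => (h₁ hx hy).trans (h₂ hy hz)

/-- One letter move is an `RC`-step. [folklore] -/
theorem RC.step {x y : Q} (s : Q) (hs : s ∈ S) (h : x * s = y) : RC x y := fun hx hy => reach_of_eq hx hy s hs h

/-- Membership of `(v, k)` in `C₂` from the two bounds (for `omega`-style side goals). [folklore] -/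
theorem mk_mem {v : Fin 4 → ℤ} {k : ℤ} (hk : -2 ≤ k ∧ k ≤ 2) (hv : -2 ≤ v 0 ∧ v 0 ≤ 2) : mk v k ∈ cylTwo :=
  mk_mem_cylTwo.2 ⟨abs_le.2 hk, abs_le.2 hv⟩

/-- Membership of `(v + W, k)` from the leading coordinate of `W`. [folklore] -/
theorem mk_add_mem {v W : Fin 4 → ℤ} {k c : ℤ} (hc : W 0 = c) (hk : -2 ≤ k ∧ k ≤ 2) (hv : -2 ≤ v 0 + c ∧ v 0 + c ≤ 2) :
    mk (v + W) k ∈ cylTwo :=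
  mk_mem hk (by rw [Pi.add_apply, hc]; exact hv)

/-- A `b`-move in normal form `(v + W, k) · b = (v + W', k)`. [folklore] -/
theorem step_b {v W A W' : Fin 4 → ℤ} {k : ℤ} (hJ : toAdd ((J ^ k) (ofAdd (e 0))) = A) (hW : W + A = W') :
    mk (v + W) k * b = mk (v + W') k := by rw [mk_mul_b, hJ, add_assoc, hW]

/-- A `b⁻¹`-move in normal form `(v + W, k) · b⁻¹ = (v + W', k)`. [folklore] -/
theorem step_b_inv {v W A W' : Fin 4 → ℤ} {k : ℤ} (hJ : toAdd ((J ^ k) (ofAdd (e 0))) = A) (hW : W - A = W') :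
    mk (v + W) k * b⁻¹ = mk (v + W') k := by rw [mk_mul_b_inv, hJ, add_sub_assoc, hW]

/-! ## §4 The three gadgets at a lattice vertex `(v, 0)` -/

/-- **Gadget `+e₁ = a b a⁻¹ b⁻¹`** at `(v, 0)`, `|v₀| ≤ 1` (levels 0, 1; excursion `v₀ + 1`). [this work] -/
theorem gadget_one (v : Fin 4 → ℤ) (hv : -1 ≤ v 0 ∧ v 0 ≤ 1) : RC (mk (v + 0) 0) (mk (v + ![0, 1, 0, 0]) 0) := by
  have ha : a ∈ S := by simp [S]
  have hai : a⁻¹ ∈ S := by simp [S]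
  have hb : b ∈ S := by simp [S]
  have hbi : b⁻¹ ∈ S := by simp [S]
  refine (RC.step a ha (mk_mul_a' _ 0 1 (by norm_num))).trans (mk_add_mem (c := 0) rfl (by norm_num) (by omega)) ?_
  refine (RC.step b hb (step_b (W' := ![1, 1, 0, 0]) Jpow_one_e0 (by decide))).trans (mk_add_mem (c := 1) rfl (by norm_num) (by omega)) ?_
  refine (RC.step a⁻¹ hai (mk_mul_a_inv' _ 1 0 (by norm_num))).trans (mk_add_mem (c := 1) rfl (by norm_num) (by omega)) ?_
  exact RC.step b⁻¹ hbi (step_b_inv (W' := ![0, 1, 0, 0]) Jpow_zero_e0 (by decide))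

/-- **Gadget `+e₂ = a a b a⁻¹ b⁻¹ a⁻¹ b a b⁻¹ a⁻¹`** at `(v, 0)`, `|v₀| ≤ 1` (levels 0, 1, 2; `J²e₀ − 2Je₀ + e₀ = e₂`). [this work] -/
theorem gadget_two (v : Fin 4 → ℤ) (hv : -1 ≤ v 0 ∧ v 0 ≤ 1) : RC (mk (v + 0) 0) (mk (v + ![0, 0, 1, 0]) 0) := by
  have ha : a ∈ S := by simp [S]
  have hai : a⁻¹ ∈ S := by simp [S]
  have hb : b ∈ S := by simp [S]
  have hbi : b⁻¹ ∈ S := by simp [S]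
  -- a a
  refine (RC.step a ha (mk_mul_a' _ 0 1 (by norm_num))).trans (mk_add_mem (c := 0) rfl (by norm_num) (by omega)) ?_
  refine (RC.step a ha (mk_mul_a' _ 1 2 (by norm_num))).trans (mk_add_mem (c := 0) rfl (by norm_num) (by omega)) ?_
  -- b at level 2: + (1,2,1,0)
  refine (RC.step b hb (step_b (W' := ![1, 2, 1, 0]) Jpow_two_e0 (by decide))).trans (mk_add_mem (c := 1) rfl (by norm_num) (by omega)) ?_
  -- a⁻¹ ; b⁻¹ at level 1: − (1,1,0,0)
  refine (RC.step a⁻¹ hai (mk_mul_a_inv' _ 2 1 (by norm_num))).trans (mk_add_mem (c := 1) rfl (by norm_num) (by omega)) ?_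
  refine (RC.step b⁻¹ hbi (step_b_inv (W' := ![0, 1, 1, 0]) Jpow_one_e0 (by decide))).trans (mk_add_mem (c := 0) rfl (by norm_num) (by omega)) ?_
  -- a⁻¹ ; b at level 0: + (1,0,0,0)
  refine (RC.step a⁻¹ hai (mk_mul_a_inv' _ 1 0 (by norm_num))).trans (mk_add_mem (c := 0) rfl (by norm_num) (by omega)) ?_
  refine (RC.step b hb (step_b (W' := ![1, 1, 1, 0]) Jpow_zero_e0 (by decide))).trans (mk_add_mem (c := 1) rfl (by norm_num) (by omega)) ?_
  -- a ; b⁻¹ at level 1: − (1,1,0,0)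
  refine (RC.step a ha (mk_mul_a' _ 0 1 (by norm_num))).trans (mk_add_mem (c := 1) rfl (by norm_num) (by omega)) ?_
  refine (RC.step b⁻¹ hbi (step_b_inv (W' := ![0, 0, 1, 0]) Jpow_one_e0 (by decide))).trans (mk_add_mem (c := 0) rfl (by norm_num) (by omega)) ?_
  -- a⁻¹
  exact RC.step a⁻¹ hai (mk_mul_a_inv' _ 1 0 (by norm_num))

/-- **Gadget `+e₃`** at `(v, 0)` with `v₀ = 0`: `b`, then `−e₁`, then `+e₂`, then `a⁻¹ b⁻¹ a` (`e₀ − e₁ + e₂ − J⁻¹e₀ = e₃`; levels `−1 … 2`). [this work] -/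
theorem gadget_three (v : Fin 4 → ℤ) (hv : v 0 = 0) : RC (mk (v + 0) 0) (mk (v + ![0, 0, 0, 1]) 0) := by
  have ha : a ∈ S := by simp [S]
  have hai : a⁻¹ ∈ S := by simp [S]
  have hb : b ∈ S := by simp [S]
  have hbi : b⁻¹ ∈ S := by simp [S]
  -- b at level 0: + (1,0,0,0)
  refine (RC.step b hb (step_b (W' := ![1, 0, 0, 0]) Jpow_zero_e0 (by decide))).trans (mk_add_mem (c := 1) rfl (by norm_num) (by omega)) ?_
  -- −e₁ : the `+e₁` gadget at `w := v + (1,−1,0,0)` reversed (`w₀ = 1`)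
  have g1 := gadget_one (v + ![1, -1, 0, 0]) (by simp [hv])
  rw [add_zero, add_assoc, show (![1, -1, 0, 0] : Fin 4 → ℤ) + ![0, 1, 0, 0] = ![1, 0, 0, 0] by decide] at g1
  refine g1.symm.trans (mk_add_mem (c := 1) rfl (by norm_num) (by omega)) ?_
  -- +e₂ : the gadget at `u := v + (1,−1,0,0)` (`u₀ = 1`)
  have g2 := gadget_two (v + ![1, -1, 0, 0]) (by simp [hv])
  rw [add_zero, add_assoc, show (![1, -1, 0, 0] : Fin 4 → ℤ) + ![0, 0, 1, 0] = ![1, -1, 1, 0] by decide] at g2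
  refine g2.trans (mk_add_mem (c := 1) rfl (by norm_num) (by omega)) ?_
  -- a⁻¹ ; b⁻¹ at level −1: − (1,−1,1,−1) ; a
  refine (RC.step a⁻¹ hai (mk_mul_a_inv' _ 0 (-1) (by norm_num))).trans (mk_add_mem (c := 1) rfl (by norm_num) (by omega)) ?_
  refine (RC.step b⁻¹ hbi (step_b_inv (W' := ![0, 0, 0, 1]) Jpow_neg_one_e0 (by decide))).trans
    (mk_add_mem (c := 0) rfl (by norm_num) (by omega)) ?_
  exact RC.step a ha (mk_mul_a' _ (-1) 0 (by norm_num))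

/-! ## §5 Every lattice vertex `(0, n₁, n₂, n₃ ; 0)` is joined to `1` -/

/-- `1 = (0, 0)`. [folklore] -/
theorem one_eq_mk : (1 : Q) = mk 0 0 := rfl

/-- `(v, 0)` with `v₀ = 0` lies in `C₂`. [folklore] -/
theorem mk_mem_of_zero {v : Fin 4 → ℤ} (hv : v 0 = 0) : mk v 0 ∈ cylTwo := mk_mem (by norm_num) (by omega)

/-- **All of `(0, n₁, n₂, n₃ ; 0)` is joined to `1` inside `C₂`** (induction on `n₁`, `n₂`, `n₃` with the three gadgets). [this work] -/
theorem rc_lattice (n₁ n₂ n₃ : ℤ) : RC (mk 0 0) (mk ![0, n₁, n₂, n₃] 0) := by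
  -- generic one-coordinate induction
  have ind : ∀ (E : Fin 4 → ℤ) (_hE : E 0 = 0) (gad : ∀ v : Fin 4 → ℤ, v 0 = 0 → RC (mk (v + 0) 0) (mk (v + E) 0))
      (w : Fin 4 → ℤ) (_hw : w 0 = 0), RC (mk 0 0) (mk w 0) → ∀ n : ℤ, RC (mk 0 0) (mk (w + n • E) 0) := by
    intro E hE gad w hw h0 n
    induction n using Int.induction_on with
    | zero => simpa using h0
    | succ m ih =>
      have hm : (w + (m : ℤ) • E) 0 = 0 := by simp [hw, hE]
      have g := gad (w + (m : ℤ) • E) hm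
      rw [add_zero] at g
      have e : w + (m : ℤ) • E + E = w + ((m : ℤ) + 1) • E := by rw [add_smul, one_smul, add_assoc]
      rw [e] at g
      exact ih.trans (mk_mem_of_zero hm) g
    | pred m ih =>
      have hm : (w + (-(m : ℤ) - 1) • E) 0 = 0 := by simp [hw, hE]
      have g := gad (w + (-(m : ℤ) - 1) • E) hm
      rw [add_zero] at g
      have e : w + (-(m : ℤ) - 1) • E + E = w + (-(m : ℤ)) • E := by rw [sub_smul, one_smul, add_assoc, sub_add_cancel]
      rw [e] at g
      exact ih.trans (mk_mem_of_zero (by simp [hw, hE])) g.symm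
  have h3 : RC (mk 0 0) (mk ((0 : Fin 4 → ℤ) + n₃ • ![0, 0, 0, 1]) 0) :=
    ind ![0, 0, 0, 1] rfl (fun v hv => gadget_three v hv) 0 rfl RC.rfl' n₃
  have h2 : RC (mk 0 0) (mk ((0 : Fin 4 → ℤ) + n₃ • ![0, 0, 0, 1] + n₂ • ![0, 0, 1, 0]) 0) :=
    ind ![0, 0, 1, 0] rfl (fun v hv => gadget_two v (by omega)) _ (by simp) h3 n₂
  have h1 : RC (mk 0 0) (mk ((0 : Fin 4 → ℤ) + n₃ • ![0, 0, 0, 1] + n₂ • ![0, 0, 1, 0] + n₁ • ![0, 1, 0, 0]) 0) :=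
    ind ![0, 1, 0, 0] rfl (fun v hv => gadget_one v (by omega)) _ (by simp) h2 n₁
  have e : (0 : Fin 4 → ℤ) + n₃ • ![0, 0, 0, 1] + n₂ • ![0, 0, 1, 0] + n₁ • ![0, 1, 0, 0] = ![0, n₁, n₂, n₃] := by
    ext i; fin_cases i <;> simp
  rw [e] at h1
  exact h1

/-! ## §6 `C₂` is connected -/

/-- `(v, 0)` is joined to `(v − v₀ e₀, 0)` by `b`-moves at level 0 (`|v₀| ≤ 2`). [folklore] -/
theorem rc_strip (v : Fin 4 → ℤ) (hv : -2 ≤ v 0 ∧ v 0 ≤ 2) : RC (mk (v + 0) 0) (mk (v + ![-(v 0), 0, 0, 0]) 0) := by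
  have hb : b ∈ S := by simp [S]
  have hbi : b⁻¹ ∈ S := by simp [S]
  -- one step down / up at level 0 from `v + (c,0,0,0)` to `v + (c',0,0,0)`
  have dn : ∀ c c' : ℤ, c - 1 = c' → RC (mk (v + ![c, 0, 0, 0]) 0) (mk (v + ![c', 0, 0, 0]) 0) := fun c c' h =>
    RC.step b⁻¹ hbi (step_b_inv Jpow_zero_e0 (by ext i; fin_cases i <;> simp [h]))
  have up : ∀ c c' : ℤ, c + 1 = c' → RC (mk (v + ![c, 0, 0, 0]) 0) (mk (v + ![c', 0, 0, 0]) 0) := fun c c' h =>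
    RC.step b hb (step_b Jpow_zero_e0 (by ext i; fin_cases i <;> simp [h]))
  have mem : ∀ c : ℤ, -2 ≤ v 0 + c → v 0 + c ≤ 2 → mk (v + ![c, 0, 0, 0]) 0 ∈ cylTwo := fun c h1 h2 =>
    mk_add_mem (c := c) rfl (by norm_num) ⟨h1, h2⟩
  have e0 : (v + 0 : Fin 4 → ℤ) = v + ![(0 : ℤ), 0, 0, 0] := by ext i; fin_cases i <;> simp
  rw [e0]
  have hv' : v 0 = -2 ∨ v 0 = -1 ∨ v 0 = 0 ∨ v 0 = 1 ∨ v 0 = 2 := by omega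
  rcases hv' with h | h | h | h | h <;> rw [h]
  · exact ((up 0 1 (by norm_num)).trans (mem 1 (by omega) (by omega)) (up 1 2 (by norm_num)))
  · exact up 0 1 (by norm_num)
  · exact RC.of_eq (by norm_num)
  · exact dn 0 (-1) (by norm_num)
  · exact ((dn 0 (-1) (by norm_num)).trans (mem (-1) (by omega) (by omega)) (dn (-1) (-2) (by norm_num)))

/-- **THE WIDTH-2 CYLINDER OF THE LETTERS CHART OF `Q` INDUCES A CONNECTED SUBGRAPH** — so `ℓ₀ = 2` is the exact (κ′) threshold of this U-customer (`C₁` is disconnected: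
`Filiform.not_connected_unitCyl`). [cite: KozmaNitzan2024, §4 p. 15 (boxes: connected induced cylinders)] -/
theorem connected_cylTwo : ((mulCayley (↑S : Set Q)).induce cylTwo).Connected := by
  have h1 : (1 : Q) ∈ cylTwo := by rw [one_eq_mk]; exact mk_mem (by norm_num) (by simp)
  haveI : Nonempty cylTwo := ⟨⟨1, h1⟩⟩
  refine ⟨fun x y => ?_⟩
  -- every vertex reaches `1`
  suffices key : ∀ z : cylTwo, ((mulCayley (↑S : Set Q)).induce cylTwo).Reachable z ⟨1, h1⟩ from (key x).trans (key y).symm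
  rintro ⟨z, hz⟩
  set v := toAdd z.left with hvdef
  set k := toAdd z.right with hkdef
  have hz' : z = mk v k := mk_eta z
  have hmem : mk v k ∈ cylTwo := hz' ▸ hz
  obtain ⟨hk, hv⟩ := mk_mem_cylTwo.1 hmem
  rw [abs_le] at hk hv
  -- (v,k) → (v,0) → (v − v₀e₀, 0) = (0,v₁,v₂,v₃ ; 0) → 1
  have r1 := reach_level_zero v (abs_le.2 hk) (abs_le.2 hv)
  have r2 := rc_strip v hv
  rw [add_zero] at r2
  have e : v + ![-(v 0), 0, 0, 0] = ![0, v 1, v 2, v 3] := by ext i; fin_cases i <;> simp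
  rw [e] at r2
  have r3 := (rc_lattice (v 1) (v 2) (v 3)).symm
  have hm0 : mk ![0, v 1, v 2, v 3] 0 ∈ cylTwo := mk_mem (by norm_num) (by simp)
  have hz0 : (⟨z, hz⟩ : cylTwo) = ⟨mk v k, hmem⟩ := Subtype.ext hz'
  rw [hz0]
  have h00 : (⟨1, h1⟩ : cylTwo) = ⟨mk 0 0, one_eq_mk ▸ h1⟩ := Subtype.ext one_eq_mk
  rw [h00]
  exact (r1.trans (r2 _ hm0)).trans (r3 hm0 _)

/-- **Row 89's (κ′) column, both halves**: `C₁` disconnected, `C₂` connected. [cite: KozmaNitzan2024, §4 p. 15] -/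
theorem cylinder_threshold_two :
    ¬ ((mulCayley (↑S : Set Q)).induce unitCyl).Connected ∧ ((mulCayley (↑S : Set Q)).induce cylTwo).Connected :=
  ⟨not_connected_unitCyl, connected_cylTwo⟩

end Filiform

end Summit.CriticalPhenomena.PercolationContinuityZ3.Theorems.Transplant

end
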